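import Literature.AlgebraicGeometry.Modules.SheafHomPullback
import Literature.AlgebraicGeometry.Modules.PullbackFrame
import Literature.AlgebraicGeometry.Modules.FrameTransition
import Literature.AlgebraicGeometry.Modules.SheafHomTranspose
import Literature.AlgebraicGeometry.Modules.SheafHomUnit
import Literature.AlgebraicGeometry.Modules.IsoOfSectionsOnBasis
import HarnessLib

/-!
# `f^* 𝓗om(A, M) ⟶ 𝓗om(f^*A, f^*M)` is an isomorphism for `A` finite locally free

Layer `Literature/AlgebraicGeometry/Modules`; sequel to `SheafHomPullback.lean` (the base-change morphism
`sheafHomPullbackComparison f A M : f^* 𝓗om(A, M) ⟶ 𝓗om(f^*A, f^*M)` for ANY morphism of schemes `f : X ⟶ Y` and ANY `𝒪_Y`-modules,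
with `pullbackHomOver f φ = «f^*φ»` on local morphisms and the ext principle `hom_ext_of_appLE_unitSection`). Here the ISOMORPHISM half
of Görtz–Wedhorn I, Exercise 7.20 (a): **for `A` locally free of finite rank, `sheafHomPullbackComparison f A M` is an isomorphism**
(`isIso_sheafHomPullbackComparison`, `sheafHomPullbackIso`), for every `𝒪_Y`-module `M`.

PROOF (no base-change isomorphism `(f^*A)|_{f⁻¹W} ≅ (f|_W)^*(A|_W)` is used). Over a frame open `W` of `A` (`e : 𝒪^I ≅ A|_W`, `I` finite):
* §1 for ANY frame `e` of a module `E` over `W` and any `N`, the SPLITTING of `𝓗om(E, N)|_W` by the frame: `ev_i = evalAt (b_i)` and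
  `sp_i : N|_W ⟶ 𝓗om(E, N)|_W`, `m ↦ λ_i(–) • m` (`frameSplit`), with `Σ_i ev_i ≫ sp_i = 𝟙` (`sum_evalAt_comp_frameSplit`: the basis
  expansion `φ = Σ_i λ_i(–) • φ(b_i)` of a local morphism, `eq_sum_restrictHom_dualBasis_comp_smulSection`);
* §2 the same splitting transported along `f^*` by `pullbackHomOver` (`P_i := f^*(ev_i)`, `S_i := f^*(sp_i)` on `(f^*𝓗om(A, M))|_{f⁻¹W}`,
  `Σ_i P_i ≫ S_i = 𝟙`, checked on pulled-back sections), and the two COMPATIBILITIES with the comparison `c = sheafHomPullbackComparison`: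
  `c| ≫ ev'_i = P_i` and `S_i ≫ c| = sp'_i`, where `ev'`, `sp'` are §1's splitting for the PULLED-BACK FRAME `pullbackFrame f e` of
  `f^*A` over `f⁻¹W` (`Modules/PullbackFrame`: basis sections `η(b_i)`); hence `d := Σ_i ev'_i ≫ S_i` is a two-sided inverse of
  `c|_{f⁻¹W}` (`isIso_sheafHomPullbackComparison_over`);
* §3 so `c` is bijective on sections over every open inside some `f⁻¹W`, `W` a frame open; these opens form a basis of `X`
  (`isBasis_setOf_le_preimage_framed`), hence `c` is an isomorphism (`Modules/IsoOfSectionsOnBasis.isIso_of_bijective_on_basis`).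

Motivation: the dual ∕ twist comparisons `f^*(E^∨) ≅ (f^*E)^∨`, `f^*(E ⊗ Ω) …` of the (L2) leg of crux stmt-HodgeConjecture-26512's support line
«sigma-descent-along-q» (the tree models `E ⊗ G` as `𝓗om(E^∨, G)`); nothing of that crux is asserted here.
Everything is proved; no named facts.

## References

* U. Görtz, T. Wedhorn, *Algebraic Geometry I: Schemes*, 2nd ed. (2020), (7.8.3) and Exercise 7.20 (a) («for `𝒢` locally free of finite
  rank, `f^*𝓗om(𝒢, 𝒢′) → 𝓗om(f^*𝒢, f^*𝒢′)` is an isomorphism»). [GortzWedhorn2020]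
* R. Hartshorne, *Algebraic Geometry*, GTM 52 (1977), II Ex. 5.1 (local frames), II.5 p. 110. [Hartshorne1977]
* The Stacks Project, Tag 01CM. [StacksProject]
-/

noncomputable section

-- `TopCat.Presheaf`/`Scheme.Modules` are not reducible (as in Mathlib's `AlgebraicGeometry/Modules/Sheaf.lean`).
set_option backward.isDefEq.respectTransparency false

open CategoryTheory AlgebraicGeometry Opposite TopologicalSpace Limits

universe u

namespace Literature.AlgebraicGeometry.Modules

open Literature.AlgebraicGeometry.Motives

/-! ### §1 The splitting of `𝓗om(E, N)|_W` by a frame of `E` over `W` -/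

section Split

variable {Z : Scheme.{u}} {E N : Z.Modules} {W V : Z.Opens} {I : Type u}
  (e : SheafOfModules.free I ≅ E.over W)

/-- `sp_i : N|_W ⟶ 𝓗om(E, N)|_W`, `m ↦ (λ_i(–) • m)` — the `i`-th coordinate of the frame times a section (`unitSmul` followed by
precomposition with the dual basis element `λ_i`). [cite: Hartshorne1977, II Ex. 5.1 (local frames and dual bases)] -/
def frameSplit (N : Z.Modules) (i : I) : N.over W ⟶ (sheafHom E N).over W :=
  (SheafOfModules.overFunctor _ W).map (unitSmul N) ≫ precompOver N (dualBasis e i)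

/-- Values of `sp_i`: `m ↦ λ_i|_V ≫ (r ↦ r • m)`. [cite: Hartshorne1977, II Ex. 5.1 (local frames and dual bases)] -/
theorem appLE_frameSplit (N : Z.Modules) (i : I) (k : V ⟶ W) (m : Γ(N, V)) :
    appLE (frameSplit e N i) k m = ((restrictHom k (dualBasis e i) ≫ smulSection m : E.over V ⟶ N.over V) : Γ(sheafHom E N, V)) :=
  rfl

variable [Fintype I]

/-- **The basis expansion of a LOCAL morphism**: for `φ : E|_V ⟶ N|_V` (`V ≤ W`), `φ = Σ_i λ_i|_V ≫ (r ↦ r • φ(b_i|_V))`.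
[cite: Hartshorne1977, II Ex. 5.1 (local frames and dual bases)] -/
theorem eq_sum_restrictHom_dualBasis_comp_smulSection (k : V ⟶ W) (φ : E.over V ⟶ N.over V) :
    φ = ∑ i, restrictHom k (dualBasis e i) ≫ smulSection (appLE φ (𝟙 V) (E.presheaf.map k.op (basisSection e i))) := by
  refine hom_ext_of_appLE fun V' k' s => ?_
  rw [appLE_sum]
  conv_lhs => rw [eq_sum_coord_smul e (k' ≫ k) s, appLE_sum_right]
  refine Finset.sum_congr rfl fun i _ => ?_
  rw [appLE_smul_right, appLE_comp, appLE_restrictHom, appLE_smulSection, ← coord_def, ← appLE_map, presheaf_map_map,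
    appLE_congr_hom φ (k' ≫ 𝟙 V) k']

/-- **`Σ_i ev_{b_i} ≫ sp_i = 𝟙`** on `𝓗om(E, N)|_W`: the frame splits the sheaf Hom. [cite: Hartshorne1977, II Ex. 5.1 (local frames and dual bases)] -/
theorem sum_evalAt_comp_frameSplit (N : Z.Modules) :
    ∑ i, evalAt (M := N) (basisSection e i) ≫ frameSplit e N i = 𝟙 ((sheafHom E N).over W) := by
  refine hom_ext_of_appLE fun V k (φ : E.over V ⟶ N.over V) => ?_
  rw [appLE_sum, appLE_id]
  conv_rhs => rw [eq_sum_restrictHom_dualBasis_comp_smulSection e k φ]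
  rfl

/-- The values of an isomorphism of restricted modules are bijections. [folklore] -/
private theorem appLE_bijective_of_isIso {P Q : Z.Modules} (χ : P.over W ⟶ Q.over W) [IsIso χ] (k : V ⟶ W) :
    Function.Bijective (appLE χ k) := by
  refine ⟨fun s t h => ?_, fun t => ⟨appLE (inv χ) k t, ?_⟩⟩
  · have h' := congrArg (appLE (inv χ) k) h
    rwa [← appLE_comp, ← appLE_comp, IsIso.hom_inv_id, appLE_id, appLE_id] at h'
  · rw [← appLE_comp, IsIso.inv_hom_id, appLE_id]

end Split

/-! ### §2 The comparison restricted to the preimage of a frame open is an isomorphism -/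

section OverIso

variable {X Y : Scheme.{u}} (f : X ⟶ Y) {A : Y.Modules} (M : Y.Modules) {W : Y.Opens} {I : Type u} [Fintype I]
  (e : SheafOfModules.free I ≅ A.over W)

/-- **The comparison on pulled-back sections**: `c(η(φ)) = f^*φ` for a local morphism `φ : A|_U ⟶ M|_U`.
[cite: GortzWedhorn2020, (7.8.3) and Exercise 7.20 (a)] -/
theorem app_sheafHomPullbackComparison_unitSection (U : Y.Opens) (φ : A.over U ⟶ M.over U) :
    (sheafHomPullbackComparison f A M).app (f ⁻¹ᵁ U) (unitSection f (sheafHom A M) U φ) =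
      (pullbackHomOver f φ :
        ((Scheme.Modules.pullback f).obj A).over (f ⁻¹ᵁ U) ⟶ ((Scheme.Modules.pullback f).obj M).over (f ⁻¹ᵁ U)) := by
  have h := homEquiv_sheafHomPullbackComparison f A M
  rw [Adjunction.homEquiv_unit] at h
  have h' := congrArg (fun ψ : sheafHom A M ⟶ (Scheme.Modules.pushforward f).obj
      (sheafHom ((Scheme.Modules.pullback f).obj A) ((Scheme.Modules.pullback f).obj M)) => (Scheme.Modules.Hom.app ψ U) φ) h
  simp only [Scheme.Modules.Hom.comp_app, Scheme.Modules.pushforward_map_app] at h'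
  exact h'

/-- `P_i := f^*(ev_{b_i})` on `(f^* 𝓗om(A, M))|_{f⁻¹W}`. [folklore] -/
private def pullP (i : I) :
    ((Scheme.Modules.pullback f).obj (sheafHom A M)).over (f ⁻¹ᵁ W) ⟶ ((Scheme.Modules.pullback f).obj M).over (f ⁻¹ᵁ W) :=
  pullbackHomOver f (evalAt (M := M) (basisSection e i))

/-- `S_i := f^*(sp_i)` on `(f^* M)|_{f⁻¹W}`. [folklore] -/
private def pullS (i : I) :
    ((Scheme.Modules.pullback f).obj M).over (f ⁻¹ᵁ W) ⟶ ((Scheme.Modules.pullback f).obj (sheafHom A M)).over (f ⁻¹ᵁ W) :=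
  pullbackHomOver f (frameSplit e M i)

/-- `Σ_i P_i ≫ S_i = 𝟙` on `(f^* 𝓗om(A, M))|_{f⁻¹W}` (checked on the pulled-back sections `η(φ)`: it is `η` of §1's expansion).
[cite: Hartshorne1977, II Ex. 5.1 (local frames and dual bases)] -/
private theorem sum_pullP_comp_pullS :
    ∑ i, pullP f M e i ≫ pullS f M e i = 𝟙 _ := by
  refine hom_ext_of_appLE_unitSection f fun W' k (φ : A.over W' ⟶ M.over W') => ?_
  rw [appLE_sum, appLE_id]
  simp only [pullP, pullS, appLE_comp, appLE_pullbackHomOver_unitSection]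
  rw [← unitSection_sum]
  congr 1
  simp only [appLE_frameSplit, appLE_evalAt]
  exact (eq_sum_restrictHom_dualBasis_comp_smulSection e k φ).symm

/-- **`c|_{f⁻¹W} ≫ ev_{η(b_i)} = P_i`**: the comparison followed by evaluation at a pulled-back basis section is `f^*` of the evaluation.
[cite: GortzWedhorn2020, (7.8.3) and Exercise 7.20 (a)] -/
private theorem comparison_over_comp_evalAt (i : I) :
    (SheafOfModules.overFunctor _ (f ⁻¹ᵁ W)).map (sheafHomPullbackComparison f A M) ≫
        evalAt (M := (Scheme.Modules.pullback f).obj M) (basisSection (pullbackFrame f e) i) =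
      pullP f M e i := by
  refine hom_ext_of_appLE_unitSection f fun W' k (φ : A.over W' ⟶ M.over W') => ?_
  rw [appLE_comp, appLE_over_map, app_sheafHomPullbackComparison_unitSection, appLE_evalAt, basisSection_pullbackFrame,
    ← unitSection_map, appLE_congr_hom (pullbackHomOver f φ) (𝟙 _) ((Opens.map f.base).map (𝟙 W')),
    appLE_pullbackHomOver_unitSection, pullP, appLE_pullbackHomOver_unitSection, appLE_evalAt]

/-- Coordinates of a pulled-back section in the pulled-back frame are the pulled-back coordinates: `λ'_i(η(a)) = f♯(λ_i(a))`.
[cite: Hartshorne1977, II.5 (p. 110) (f^* of a locally free sheaf, same local bases)] -/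
theorem coord_pullbackFrame_unitSection {W' : Y.Opens} (k : W' ⟶ W) (a : Γ(A, W')) (i : I) :
    coord (pullbackFrame f e) ((Opens.map f.base).map k) (unitSection f A W' a) i = f.app W' (coord e k a i) := by
  classical
  conv_lhs => rw [eq_sum_coord_smul e k a, unitSection_sum]
  simp_rw [unitSection_smul, unitSection_map, ← basisSection_pullbackFrame]
  rw [coord_sum_smul_basisSection]

/-- `f^*` of «multiplication by `m`» on a pulled-back function: `(f^*(r ↦ r • m))(η(r)) = f♯(r) • η(m)`. [folklore] -/
private theorem appLE_pullbackHomOver_smulSection {W' W₀ : Y.Opens} (m : Γ(M, W')) (k₀ : W₀ ⟶ W') (r : Γ(Y, W₀)) :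
    appLE (pullbackHomOver f (smulSection m)) ((Opens.map f.base).map k₀) (unitSection f (unitModule Y) W₀ r) =
      f.app W₀ r • ((Scheme.Modules.pullback f).obj M).presheaf.map ((Opens.map f.base).map k₀).op (unitSection f M W' m) := by
  rw [appLE_pullbackHomOver_unitSection, appLE_smulSection, unitSection_smul, unitSection_map]

/-- **`S_i ≫ c|_{f⁻¹W} = sp'_i`**: `f^*` of the `i`-th splitting map followed by the comparison is the `i`-th splitting map of the
pulled-back frame. [cite: GortzWedhorn2020, (7.8.3) and Exercise 7.20 (a)] -/
private theorem pullS_comp_comparison_over (i : I) :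
    pullS f M e i ≫ (SheafOfModules.overFunctor _ (f ⁻¹ᵁ W)).map (sheafHomPullbackComparison f A M) =
      frameSplit (pullbackFrame f e) ((Scheme.Modules.pullback f).obj M) i := by
  refine hom_ext_of_appLE_unitSection f fun W' k (m : Γ(M, W')) => ?_
  rw [appLE_comp, pullS, appLE_pullbackHomOver_unitSection, appLE_over_map, app_sheafHomPullbackComparison_unitSection,
    appLE_frameSplit, appLE_frameSplit, pullbackHomOver_comp]
  -- both sides are morphisms `(f^*A)|_{f⁻¹W'} ⟶ (f^*M)|_{f⁻¹W'}`; compare on pulled-back sections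
  refine hom_ext_of_appLE_unitSection f fun W₀ k₀ (a : Γ(A, W₀)) => ?_
  have hk : (Opens.map f.base).map k₀ ≫ (Opens.map f.base).map k = (Opens.map f.base).map (k₀ ≫ k) := Subsingleton.elim _ _
  simp only [appLE_comp, appLE_restrictHom]
  rw [appLE_pullbackHomOver_unitSection, appLE_restrictHom]
  simp only [← coord_def]
  rw [appLE_pullbackHomOver_smulSection, appLE_smulSection, hk, coord_pullbackFrame_unitSection]

/-- The candidate inverse `d := Σ_i ev_{η(b_i)} ≫ S_i : 𝓗om(f^*A, f^*M)|_{f⁻¹W} ⟶ (f^* 𝓗om(A, M))|_{f⁻¹W}`.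
[cite: GortzWedhorn2020, (7.8.3) and Exercise 7.20 (a)] -/
def sheafHomPullbackComparisonOverInv :
    (sheafHom ((Scheme.Modules.pullback f).obj A) ((Scheme.Modules.pullback f).obj M)).over (f ⁻¹ᵁ W) ⟶
      ((Scheme.Modules.pullback f).obj (sheafHom A M)).over (f ⁻¹ᵁ W) :=
  ∑ i, evalAt (M := (Scheme.Modules.pullback f).obj M) (basisSection (pullbackFrame f e) i) ≫ pullS f M e i

/-- `c|_{f⁻¹W} ≫ d = 𝟙`. [cite: GortzWedhorn2020, (7.8.3) and Exercise 7.20 (a)] -/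
theorem comparison_over_comp_inv :
    (SheafOfModules.overFunctor _ (f ⁻¹ᵁ W)).map (sheafHomPullbackComparison f A M) ≫ sheafHomPullbackComparisonOverInv f M e = 𝟙 _ := by
  rw [sheafHomPullbackComparisonOverInv, Preadditive.comp_sum]
  simp_rw [← Category.assoc, comparison_over_comp_evalAt]
  exact sum_pullP_comp_pullS f M e

/-- `d ≫ c|_{f⁻¹W} = 𝟙`. [cite: GortzWedhorn2020, (7.8.3) and Exercise 7.20 (a)] -/
theorem inv_comp_comparison_over :
    sheafHomPullbackComparisonOverInv f M e ≫ (SheafOfModules.overFunctor _ (f ⁻¹ᵁ W)).map (sheafHomPullbackComparison f A M) = 𝟙 _ := by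
  rw [sheafHomPullbackComparisonOverInv, Preadditive.sum_comp]
  simp_rw [Category.assoc, pullS_comp_comparison_over]
  exact sum_evalAt_comp_frameSplit (pullbackFrame f e) ((Scheme.Modules.pullback f).obj M)

include e in
/-- **Over the preimage of a frame open of `A`, the comparison is an isomorphism.** [cite: GortzWedhorn2020, (7.8.3) and Exercise 7.20 (a)] -/
theorem isIso_sheafHomPullbackComparison_over :
    IsIso ((SheafOfModules.overFunctor _ (f ⁻¹ᵁ W)).map (sheafHomPullbackComparison f A M)) :=
  ⟨sheafHomPullbackComparisonOverInv f M e, comparison_over_comp_inv f M e, inv_comp_comparison_over f M e⟩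

end OverIso

/-! ### §3 The comparison is an isomorphism for `A` finite locally free -/

section Iso

variable {X Y : Scheme.{u}} (f : X ⟶ Y) {A : Y.Modules}

/-- The opens of `X` lying inside the preimage of some trivialising open of `A` form a basis (every point `x` has `f x` in a trivialising
open). [cite: StacksProject, Tag 01C6 (Modules Def. 17.14.1 (2))] -/
theorem isBasis_setOf_le_preimage_framed (hA : IsFiniteLocallyFree A) :
    Opens.IsBasis {V : X.Opens | ∃ (W : Y.Opens) (_ : V ⟶ f ⁻¹ᵁ W) (I : Type u),
      Finite I ∧ Nonempty (SheafOfModules.free I ≅ A.over W)} := by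
  rw [Opens.isBasis_iff_nbhd]
  intro U x hx
  obtain ⟨W, hxW, I, hI, ⟨e⟩⟩ := hA (f.base x)
  exact ⟨U ⊓ f ⁻¹ᵁ W, ⟨W, homOfLE inf_le_right, I, hI, ⟨e⟩⟩, ⟨hx, hxW⟩, inf_le_left⟩

/-- **`f^* 𝓗om(A, M) ⟶ 𝓗om(f^*A, f^*M)` IS AN ISOMORPHISM FOR `A` FINITE LOCALLY FREE** (Görtz–Wedhorn I, Exercise 7.20 (a)), for every
morphism of schemes `f` and every `𝒪_Y`-module `M`: bijective on sections over the basis of opens inside the preimages of trivialising opens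
(`isIso_sheafHomPullbackComparison_over`), hence an isomorphism (`isIso_of_bijective_on_basis`).
[cite: GortzWedhorn2020, (7.8.3) and Exercise 7.20 (a)] -/
theorem isIso_sheafHomPullbackComparison (hA : IsFiniteLocallyFree A) (M : Y.Modules) :
    IsIso (sheafHomPullbackComparison f A M) := by
  refine isIso_of_bijective_on_basis _ (isBasis_setOf_le_preimage_framed f hA) fun V hV => ?_
  obtain ⟨W, k, I, hI, ⟨e⟩⟩ := hV
  haveI := Fintype.ofFinite I
  haveI := isIso_sheafHomPullbackComparison_over f M e
  exact appLE_bijective_of_isIso ((SheafOfModules.overFunctor _ (f ⁻¹ᵁ W)).map (sheafHomPullbackComparison f A M)) k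

/-- **`f^* 𝓗om(A, M) ≅ 𝓗om(f^*A, f^*M)` for `A` finite locally free.** [cite: GortzWedhorn2020, (7.8.3) and Exercise 7.20 (a)] -/
def sheafHomPullbackIso (hA : IsFiniteLocallyFree A) (M : Y.Modules) :
    (Scheme.Modules.pullback f).obj (sheafHom A M) ≅ sheafHom ((Scheme.Modules.pullback f).obj A) ((Scheme.Modules.pullback f).obj M) :=
  haveI := isIso_sheafHomPullbackComparison f hA M
  asIso (sheafHomPullbackComparison f A M)

end Iso



end Literature.AlgebraicGeometry.Modules

end
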